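import Summits.HodgeConjecture.HodgeCM.Model.EndStatePerLAxioms_1

/-! PORT of `HodgeCM/Model/EndStatePerLAxioms.lean` (HodgeCMPerL run 82) — part 2: continuation of `Summits.HodgeConjecture.HodgeCM.Model.EndStatePerLAxioms_1` (split at a top-level declaration boundary by port_pkg.py; scope re-opened below; declarations unchanged). -/

-- port_pkg: scope re-opened for this part (file-level context, then the namespace/section stack open at the cut)
noncomputable section
open scoped TensorProduct InnerProductSpace Matrix
namespace HodgeCM
open Literature.AlgebraicGeometry.Motives (CMType HodgeStructure)
open Literature.AlgebraicGeometry.Motives.HodgeStructure (conj)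
open HodgeCM.Prior.Perl34File
namespace Assembly
open HodgeCM.Universe (AdelicThetaCore₀ SideData ThetaModel ModelAxiomsPerL)
variable (U : Universe)
/-- … and so is the realisation END STATE of record. -/
theorem realisationExists_endStateOfRecord (M : U.ModelAxioms) (h : Bool) (C : U.AdelicThetaCore₀)
    (d12 d34 : ∀ {L : CMField}, SeesawCtx L → SideData L)
    (A : (C.thetaModel h d12 d34).AllCharsNonDesign) (hHR : U.Fact_hodgeRiemann20) :
    U.RealisationExistsPerL ∧ U.RealisationExistsFace :=
  realisationExists_ofSignRecipe₇' U M.toPerL h C d12 d34 A hHR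

end Assembly
end HodgeCM
end
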